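import Mathlib.RepresentationTheory.Irreducible
import Mathlib.LinearAlgebra.Semisimple
import Mathlib.FieldTheory.Separable
import Literature.NumberTheory.Automorphic.JordanDecompositionAlgGroup
import Summits.Langlands.Langlands.Theorems.IrreducibilityBySelfDualityReciprocityUpToIrreducibilityRStringDefs
import HarnessLib

/-!
# Route IrreducibilityBySelfDuality, crux `ReciprocityUpToIrreducibilityR` (stmt-Langlands-17925), line `Sketch`:
# stub W-a `stub_stringModel_isFrobSemisimple_isIndecomposable` (`--supports` file; no definitions)

**The standard string `ρ ⊗ Sp(d)` is a Frobenius-semisimple indecomposable Weil–Deligne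
representation** (for `ρ` an irreducible continuous representation of `W_F` with semisimple
`ρ(w)`, and `0 < d`).  These are the probes `τ` fed to Henniart's characterisation
(Bull. SMF 130 (2002), Thm 1.7 (a): indecomposable Frobenius-semisimple `τ` of dimension `< n`).

The model is the vocabulary file's `stringModel ρ hρ d` on `Fin d → H`: slot `j` carries the
unramified twist `w ↦ (q^{deg w})^j ρ(w)` and the monodromy `N` is the shift of slot `j` to slot
`j + 1` (Tate, *Number theoretic background*, Corvallis 1979, (4.1.4)–(4.1.5)).

* Frobenius-semisimplicity (`isFrobSemisimple_stringModel`): `ρ_d(w) = D ∘ R` with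
  `R = (ρ(w), …, ρ(w))` (Mathlib `LinearMap.compLeft`; killed by the square-free minimal
  polynomial of `ρ(w)`: the tree's `Literature.NumberTheory.Automorphic.isSemisimple_compLeft`)
  and `D` the diagonal operator
  with entries `c^j`, `c = q^{deg w}` (killed by the separable polynomial `∏_{a ∈ {c^j}} (X - a)`);
  `D` and `R` commute, and a product of commuting semisimple endomorphisms over the perfect field
  `ℂ` is semisimple (`Module.End.IsSemisimple.mul_of_commute`).
* Indecomposability (`isIndecomposable_stringModel`): `ker N` is the last slot, and the pull-back
  of a `W_F`-stable subspace `p` along `x ↦ (0, …, 0, x)` is a subrepresentation of the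
  irreducible `ρ` (the scalar `c^{d-1}` is invertible), hence `⊥` or `⊤`; an `N`-stable subspace
  meeting the last slot (= `ker N`) trivially is trivial (`N` is nilpotent); and two complementary
  sub-Weil–Deligne representations cannot both contain the last slot.

References: J. Tate, *Number theoretic background*, Corvallis 1979, (4.1.4)–(4.1.5); P. Deligne,
*Les constantes des équations fonctionnelles des fonctions L*, Antwerp II, LNM 349 (1973), §8.4–8.6;
G. Henniart, Bull. SMF 130 (2002), §1.7.  Standard axioms only; no `sorry`.
-/

noncomputable section

set_option linter.dupNamespace false -- `Summit.Langlands.Langlands` is the mandated namespace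

open Module Polynomial
open Literature.NumberTheory.Automorphic Literature.NumberTheory.GaloisRepresentations
open Literature.NumberTheory.GaloisRepresentations.WeilGroup
open Literature.NumberTheory.GaloisRepresentations.IsNonarchimedeanLocalField

namespace Summit.Langlands.Langlands.Theorems.ReciprocityUpToIrreducibilityR

/-! ## Linear algebra: diagonal endomorphisms of `ι → V` are semisimple

(The componentwise endomorphism `(f, …, f) = f.compLeft ι` of a semisimple `f` is semisimple:
`Literature.NumberTheory.Automorphic.isSemisimple_compLeft`.) -/

section LinearAlgebra

variable {k : Type*} [Field k] {V : Type*} [AddCommGroup V] [Module k V] {ι : Type*}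

/-- Powers of the diagonal endomorphism `(x_i)_i ↦ (a_i x_i)_i` of `ι → V` are diagonal with
entries `a_i ^ n`. [folklore] -/
theorem diag_pow_apply (a : ι → k) (n : ℕ) (x : ι → V) (i : ι) :
    ((LinearMap.pi fun i => a i • (LinearMap.proj i : (ι → V) →ₗ[k] V)) ^ n) x i =
      a i ^ n • x i := by
  induction n generalizing x with
  | zero => simp
  | succ n ih =>
    rw [pow_succ, Module.End.mul_apply, ih, pow_succ, mul_smul, LinearMap.pi_apply,
      LinearMap.smul_apply, LinearMap.proj_apply, smul_comm]

/-- Polynomials in the diagonal endomorphism `(x_i)_i ↦ (a_i x_i)_i` act on the `i`-th component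
by their value at `a_i`. [folklore] -/
theorem aeval_diag_apply (a : ι → k) (p : k[X]) (x : ι → V) (i : ι) :
    aeval (LinearMap.pi fun i => a i • (LinearMap.proj i : (ι → V) →ₗ[k] V)) p x i =
      p.eval (a i) • x i := by
  refine p.induction_on' ?_ ?_
  · intro p q hp hq
    simp [hp, hq, add_smul]
  · intro n b
    simp only [aeval_monomial, Module.End.mul_apply, Module.algebraMap_end_apply, Pi.smul_apply,
      diag_pow_apply, eval_monomial, mul_smul]

/-- **A diagonal endomorphism with finitely many entries is semisimple**: `(x_i)_i ↦ (a_i x_i)_i`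
is killed by the separable — hence square-free — polynomial `∏_{a ∈ {a_i}} (X - a)`
(`Polynomial.separable_prod_X_sub_C_iff'`, `Module.End.isSemisimple_of_squarefree_aeval_eq_zero`).
[folklore] -/
theorem isSemisimple_diag [Fintype ι] (a : ι → k) :
    Module.End.IsSemisimple
      (LinearMap.pi fun i => a i • (LinearMap.proj i : (ι → V) →ₗ[k] V)) := by
  classical
  have hsep : (∏ b ∈ Finset.univ.image a, (X - C b) : k[X]).Separable :=
    separable_prod_X_sub_C_iff'.mpr fun x _ y _ h => h
  refine Module.End.isSemisimple_of_squarefree_aeval_eq_zero hsep.squarefree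
    (LinearMap.ext fun x => funext fun i => ?_)
  rw [aeval_diag_apply, eval_prod,
    Finset.prod_eq_zero (Finset.mem_image_of_mem a (Finset.mem_univ i))
      (by rw [eval_sub, eval_X, eval_C, sub_self]),
    zero_smul, LinearMap.zero_apply, Pi.zero_apply]

end LinearAlgebra

/-! ## The standard string is Frobenius-semisimple -/

section Model

variable {F : Type} [Field F] [ValuativeRel F] [TopologicalSpace F] [IsNonarchimedeanLocalField F]
variable {H : Type*} [AddCommGroup H] [Module ℂ H]

/-- **`ρ ⊗ Sp(d)` is Frobenius-semisimple when every `ρ(w)` is semisimple**: `ρ_d(w) = D ∘ R`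
with `R = (ρ(w), …, ρ(w))` semisimple, `D = diag((q^{deg w})^j)` semisimple, `D R = R D`, and a
product of commuting semisimple endomorphisms of a finite-dimensional complex vector space is
semisimple (`Module.End.IsSemisimple.mul_of_commute`).
Ref: Tate, *Number theoretic background* (Corvallis 1979), (4.1.3)–(4.1.5).
[cite: TateCorvallis1979, (4.1.4)–(4.1.5)] -/
theorem isFrobSemisimple_stringModel [FiniteDimensional ℂ H]
    (ρ : Representation ℂ (WeilGroup F) H) (hρ : WeilGroup.IsContinuousRep ρ)
    (hss : ∀ w : WeilGroup F, Module.End.IsSemisimple (ρ w)) (d : ℕ) :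
    (stringModel ρ hρ d).IsFrobSemisimple := by
  intro w
  let c : ℂ := (residueFieldCard F : ℂ) ^ (deg w)
  let D : Module.End ℂ (Fin d → H) :=
    LinearMap.pi fun j : Fin d => c ^ (j : ℕ) • (LinearMap.proj j : (Fin d → H) →ₗ[ℂ] H)
  let R : Module.End ℂ (Fin d → H) := (ρ w).compLeft (Fin d)
  have hT : (stringModel ρ hρ d).ρ w = D * R := LinearMap.ext fun y => funext fun j => rfl
  have hcomm : Commute D R := by
    change D * R = R * D
    refine LinearMap.ext fun y => funext fun j => ?_
    simp only [D, R, Module.End.mul_apply, LinearMap.pi_apply, LinearMap.smul_apply,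
      LinearMap.proj_apply, LinearMap.compLeft_apply, Function.comp_apply, map_smul]
  rw [hT]
  exact Module.End.IsSemisimple.mul_of_commute hcomm
    (isSemisimple_diag (V := H) fun j : Fin d => c ^ (j : ℕ)) (isSemisimple_compLeft (hss w))

/-! ## The standard string is indecomposable -/

/-- **The kernel of the shift is the last slot**: if `N y = 0` for the shift `N` of `Fin (d+1) → H`
then `y = (0, …, 0, y_d)`. [folklore] -/
theorem eq_single_of_shiftMap_eq_zero {d : ℕ} {z : Fin (d + 1) → H}
    (hz : shiftMap H (d + 1) z = 0) : z = Pi.single (Fin.last d) (z (Fin.last d)) := by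
  funext j
  by_cases hj : j = Fin.last d
  · rw [hj, Pi.single_eq_same]
  · rw [Pi.single_eq_of_ne hj]
    have hlt : (j : ℕ) < d := Fin.val_lt_last hj
    have h := congr_fun hz ⟨(j : ℕ) + 1, by omega⟩
    rw [shiftMap_apply, dif_neg (Nat.succ_ne_zero _), Pi.zero_apply] at h
    simpa using h

/-- **The last slot carries `ρ ⊗ ‖·‖^d`**:
`ρ_{d+1}(w) (0, …, 0, x) = (q^{deg w})^d • (0, …, 0, ρ(w) x)`. [cite: TateCorvallis1979, (4.1.4)] -/
theorem stringModelRep_single (ρ : Representation ℂ (WeilGroup F) H) (d : ℕ) (w : WeilGroup F)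
    (x : H) : stringModelRep ρ (d + 1) w (Pi.single (Fin.last d) x) =
      (((residueFieldCard F : ℂ) ^ (deg w)) ^ d) • Pi.single (Fin.last d) (ρ w x) := by
  funext j
  rw [stringModelRep_apply, Pi.smul_apply]
  by_cases hj : j = Fin.last d
  · rw [hj, Pi.single_eq_same, Pi.single_eq_same, Fin.val_last]
  · rw [Pi.single_eq_of_ne hj, Pi.single_eq_of_ne hj, map_zero, smul_zero, smul_zero]

/-- **The pull-back of a `W_F`-stable subspace along the last slot is `ρ`-stable**: if
`(0, …, 0, x) ∈ p` then `(0, …, 0, ρ(w) x) = ((q^{deg w})^d)⁻¹ • ρ_{d+1}(w) (0, …, 0, x) ∈ p`.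
[cite: TateCorvallis1979, (4.1.4)–(4.1.5)] -/
theorem single_apply_mem_of_isWStable (ρ : Representation ℂ (WeilGroup F) H) {d : ℕ}
    {p : Submodule ℂ (Fin (d + 1) → H)}
    (hp : ∀ w : WeilGroup F, p ≤ p.comap (stringModelRep ρ (d + 1) w))
    (w : WeilGroup F) {x : H} (hx : Pi.single (Fin.last d) x ∈ p) :
    Pi.single (Fin.last d) (ρ w x) ∈ p := by
  have h := hp w hx
  rw [Submodule.mem_comap, stringModelRep_single] at h
  have h' := p.smul_mem ((((residueFieldCard F : ℂ) ^ (deg w)) ^ d)⁻¹) h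
  rwa [smul_smul, inv_mul_cancel₀ (qpow_ne_zero w d), one_smul] at h'

/-- **Dichotomy for the last slot of a `W_F`-stable subspace** (`ρ` irreducible): the pull-back of a
`W_F`-stable `p ≤ Fin (d+1) → H` along `x ↦ (0, …, 0, x)` is a subrepresentation of `ρ`
(`single_apply_mem_of_isWStable`), hence `⊥` or `⊤` (Mathlib `Representation.IsIrreducible` =
`IsSimpleOrder (Subrepresentation ρ)`): either the last slot meets `p` trivially, or it lies in `p`.
[cite: TateCorvallis1979, (4.1.5)] -/
theorem last_slot_dichotomy (ρ : Representation ℂ (WeilGroup F) H) [ρ.IsIrreducible] {d : ℕ}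
    {p : Submodule ℂ (Fin (d + 1) → H)}
    (hp : ∀ w : WeilGroup F, p ≤ p.comap (stringModelRep ρ (d + 1) w)) :
    (∀ x : H, Pi.single (Fin.last d) x ∈ p → x = 0) ∨
      ∀ x : H, Pi.single (Fin.last d) x ∈ p := by
  classical
  let A : Subrepresentation ρ :=
    ⟨p.comap (LinearMap.single ℂ (fun _ : Fin (d + 1) => H) (Fin.last d)), fun w x hx => by
      rw [Submodule.mem_comap, LinearMap.coe_single] at hx ⊢
      exact single_apply_mem_of_isWStable ρ hp w hx⟩
  rcases IsSimpleOrder.eq_bot_or_eq_top A with hA | hA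
  · refine Or.inl fun x hx => ?_
    have hx' : x ∈ A.toSubmodule := by
      rw [Submodule.mem_comap, LinearMap.coe_single]
      exact hx
    rw [congrArg Subrepresentation.toSubmodule hA] at hx'
    exact (Submodule.mem_bot ℂ).mp hx'
  · refine Or.inr fun x => ?_
    have hx' : x ∈ A.toSubmodule := by
      rw [congrArg Subrepresentation.toSubmodule hA]
      exact Submodule.mem_top
    rw [Submodule.mem_comap, LinearMap.coe_single] at hx'
    exact hx'

/-- **An `N`-stable subspace of the standard string meeting the last slot trivially is trivial**:
`p ∩ ker N = 0` (the kernel of the shift is the last slot) gives `p ∩ ker N^k = 0` for all `k` by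
induction (`N z ∈ p ∩ ker N^k`), and `N^{d+1} = 0`. [cite: TateCorvallis1979, (4.1.5)] -/
theorem eq_bot_of_isSubrep_of_last_slot (ρ : Representation ℂ (WeilGroup F) H)
    (hρ : WeilGroup.IsContinuousRep ρ) {d : ℕ} {p : Submodule ℂ (Fin (d + 1) → H)}
    (hp : (stringModel ρ hρ (d + 1)).IsSubrep p)
    (h0 : ∀ x : H, Pi.single (Fin.last d) x ∈ p → x = 0) : p = ⊥ := by
  have h1 : ∀ z ∈ p, shiftMap H (d + 1) z = 0 → z = 0 := by
    intro z hz hNz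
    rw [eq_single_of_shiftMap_eq_zero hNz] at hz ⊢
    rw [h0 _ hz, Pi.single_zero]
  have hk : ∀ k : ℕ, ∀ z ∈ p, (shiftMap H (d + 1) ^ k) z = 0 → z = 0 := by
    intro k
    induction k with
    | zero =>
      intro z _ h
      simpa using h
    | succ k ih =>
      intro z hz h
      rw [pow_succ, Module.End.mul_apply] at h
      exact h1 z hz (ih _ (hp.2 hz) h)
  refine (Submodule.eq_bot_iff p).mpr fun z hz => hk (d + 1) z hz ?_
  rw [shiftMap_pow_eq_zero, LinearMap.zero_apply]

/-- **`ρ ⊗ Sp(d)` is indecomposable** (`ρ` irreducible, `H ≠ 0`, `0 < d`): if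
`Fin d → H = p ⊕ p'` with sub-Weil–Deligne representations `p, p'`, the last slot (`= ker N`, an
irreducible `W_F`-space) meets `p` trivially or lies in `p` (`last_slot_dichotomy`); in the first
case `p = 0`, in the second the last slot meets `p'` trivially (`p ⊓ p' = 0`) and `p' = 0`
(`eq_bot_of_isSubrep_of_last_slot`).  Ref: Tate, *Number theoretic background* (Corvallis 1979),
(4.1.5) ("the indecomposable … are those of the form `ρ ⊗ sp(n)` with `ρ` irreducible").
[cite: TateCorvallis1979, (4.1.5)] -/
theorem isIndecomposable_stringModel [Nontrivial H] (ρ : Representation ℂ (WeilGroup F) H)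
    (hρ : WeilGroup.IsContinuousRep ρ) [ρ.IsIrreducible] {d : ℕ} (hd : 0 < d) :
    (stringModel ρ hρ d).IsIndecomposable := by
  obtain ⟨d, rfl⟩ : ∃ d', d = d' + 1 := ⟨d - 1, by omega⟩
  refine ⟨inferInstance, fun p p' hp hp' hc => ?_⟩
  rcases last_slot_dichotomy ρ (p := p) hp.1 with h | h
  · exact Or.inl (eq_bot_of_isSubrep_of_last_slot ρ hρ hp h)
  · refine Or.inr (eq_bot_of_isSubrep_of_last_slot ρ hρ hp' fun x hx => ?_)
    have hx' : Pi.single (Fin.last d) x ∈ p ⊓ p' := ⟨h x, hx⟩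
    rw [hc.inf_eq_bot, Submodule.mem_bot] at hx'
    exact Pi.single_eq_zero_iff.mp hx'

end Model

/-- **Registered sub-goal W-a `stub_stringModel_isFrobSemisimple_isIndecomposable`**: for an
irreducible continuous representation `ρ` of `W_F` on `H ≠ 0` with every `ρ(w)` semisimple and
`0 < d`, the standard string `ρ ⊗ Sp(d)` (`stringModel ρ hρ d` on `Fin d → H`) is a
Frobenius-semisimple (`isFrobSemisimple_stringModel`) and indecomposable
(`isIndecomposable_stringModel`) Weil–Deligne representation — the probes of Henniart 2002,
Thm 1.7 (a).  Ref: Tate, *Number theoretic background* (Corvallis 1979), (4.1.4)–(4.1.5);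
Henniart, Bull. SMF 130 (2002), §1.7. [cite: TateCorvallis1979, (4.1.4)–(4.1.5)] -/
theorem stub_stringModel_isFrobSemisimple_isIndecomposable : ∀ (F : Type) [Field F] [ValuativeRel F] [TopologicalSpace F] [IsNonarchimedeanLocalField F] (H : Type) [AddCommGroup H] [Module ℂ H] [FiniteDimensional ℂ H] [Nontrivial H] (ρ : Representation ℂ (WeilGroup F) H) (hρ : WeilGroup.IsContinuousRep ρ) [ρ.IsIrreducible], (∀ w : WeilGroup F, Module.End.IsSemisimple (ρ w)) → ∀ (d : ℕ), 0 < d → (stringModel ρ hρ d).IsFrobSemisimple ∧ (stringModel ρ hρ d).IsIndecomposable :=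
  fun _ _ _ _ _ _ _ _ _ _ ρ hρ _ hss d hd =>
    ⟨isFrobSemisimple_stringModel ρ hρ hss d, isIndecomposable_stringModel ρ hρ hd⟩

end Summit.Langlands.Langlands.Theorems.ReciprocityUpToIrreducibilityR

end
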